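import Literature.AlgebraicTopology.SingularHomology.RelativeHomeomorphismExcision
import Literature.AlgebraicGeometry.HodgeTheory.BirationalMorphismDegree
import Literature.AlgebraicGeometry.HodgeTheory.ComplexPointsLocallyContractible
import Literature.AlgebraicGeometry.HodgeTheory.ThomGysinClosedImmersion
import HarnessLib

/-!
# Transfer of Deligne's kernel `Ker(Hᵠ(X) → Hᵠ(Z))` along a proper modification which is an
# isomorphism off `Z`

Family `hodge`, layer `Literature/AlgebraicGeometry/HodgeTheory`. Support file (theorems only) for
the named fact `Deligne1974_ker_pullback_eq_ker_pullback_resolution` (`GysinKernelSplit.lean`;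
P. Deligne, *Théorie de Hodge III*, Prop. 8.2.7: for `X` smooth projective, `Z ⊆ X` closed and
`π : Z̃ → Z` a surjection from a smooth projective `Z̃`, `Ker(Hᵠ(X) → Hᵠ(Z)) = Ker(Hᵠ(X) → Hᵠ(Z̃))`).
Every proof of Prop. 8.2.7 for a SINGULAR `Z` passes through a resolution; this file provides the
step which moves the statement from `Z ⊆ X` to the exceptional locus `E = σ⁻¹(Z) ⊆ X̃` of a
proper modification `σ : X̃ → X` which is an isomorphism off `Z` (a composite of blow-ups along
smooth centres over `Z`, an embedded resolution / principalization of `Z ⊆ X`; Hironaka 1964,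
Kollár 2007 Thm. 3.26):

> (**transfer**) for `X̃`, `X` smooth projective of dimension `n`, `σ : X̃ ⟶ X` birational and an
> isomorphism over the open `U = X ∖ Z`, and `v ∈ Hᵠ(X(ℂ); ℂ)`: if `σ^* v` vanishes on
> `E(ℂ) = σ⁻¹(Z)(ℂ)` then `v` vanishes on `Z(ℂ)`
> (`singularCohomology_map_eq_zero_of_map_preimage_eq_zero_of_isIso_restrict`).

The printed argument (C. Voisin, *Hodge Theory II* (2003), proof of Thm. 10.17 / Lemma 10.18 for
the same square; Spanier 1966 Ch. 6 §6 Thm. 5 for the topology): the square of pairs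
`(X̃(ℂ), E(ℂ)) → (X(ℂ), Z(ℂ))` is a RELATIVE HOMEOMORPHISM of compact pairs whose closed sets are
locally contractible (complex projective algebraic sets; the tree's
`locallyContractibleSpace_complexPoints_of_isSmoothProjective`, from the proved semialgebraic
triangulation theorem), hence induces isomorphisms `Hᵠ(X, Z) ≅ Hᵠ(X̃, E)`
(`bijective_relMap_of_relativeHomeomorph`, `RelativeHomeomorphismExcision.lean`); and
`σ^* : Hᵠ(X) → Hᵠ(X̃)` is injective because `σ` has degree one
(`exists_hasDegree_one_of_isBirational`, projection formula `σ_!σ^* = id`,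
`gysinMap_map_of_hasDegree`). A chase in the ladder of the two long exact sequences concludes.

## Contents (all proved)

* `nonempty_retractionNhds_of_locallyContractibleSpace` — closed, locally contractible subsets of
  compact manifolds carry tautness data (Spanier 6.1.10, Hatcher Cor. A.9; packaging of the
  tree's ENR theorem);
* `bijective_relMap_of_relativeHomeomorph_of_chartedSpace` — relative-homeomorphism excision for
  compact manifolds and locally contractible closed sets;
* `singularCohomology_map_subsetIncl_eq_zero_of_map_preimage` — the abstract transfer: relative
  `f^*` surjective and absolute `f^*` injective ⟹ (`f^* v|_{f⁻¹K} = 0 ⟹ v|_K = 0`);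
* `complexBetti_map_injective_of_isBirational` — `σ^*` is injective for `σ` birational between
  smooth projective `n`-folds;
* `AlgPoints.eq_of_map_eq_of_isIso_restrict`, `AlgPoints.exists_map_eq_of_isIso_restrict` — a
  morphism which is an isomorphism over an open `U` is bijective on complex points over `U(ℂ)`;
* `singularCohomology_map_eq_zero_of_map_preimage_eq_zero_of_isIso_restrict` — the transfer for
  complex points of smooth projective varieties.

No definitions, no named facts (D-0026).

## References

* [DeligneHodgeIII1974] P. Deligne, Théorie de Hodge III, Publ. Math. IHÉS 44 (1974), Prop. 8.2.7.
* [VoisinHodgeII2003] C. Voisin, Hodge Theory and Complex Algebraic Geometry II, CUP 2003, §10.2,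
  proof of Thm. 10.17 (the square of a desingularisation).
* [Spanier1981] E. H. Spanier, Algebraic Topology, Springer 1981, Ch. 6 §1 Thm. 10, §6 Thm. 5.
* [Fulton1998] W. Fulton, Intersection Theory, 2nd ed. (1998), Lemma 19.1.2 (`σ_*[X̃] = [X]`).
* [Kollar2007] J. Kollár, Lectures on Resolution of Singularities (2007), Thm. 3.26.
-/

noncomputable section

open CategoryTheory AlgebraicGeometry Set
open Literature.AlgebraicTopology.SingularHomology Literature.AlgebraicTopology.Homotopy

namespace Literature.AlgebraicGeometry.HodgeTheory

/-! ### Topological part: compact manifolds, locally contractible closed subsets -/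

section Topological

universe u v

variable {R : Type v} [CommRing R] {Md : Type v} [AddCommGroup Md] [Module R Md]

/-- **Closed, locally contractible subsets of compact manifolds are taut** (Spanier 1966, Ch. 6 §1
Thm. 10 and Cor. 11; Hatcher 2002, Thm. A.7 / Cor. A.9 — all proved in the tree): for `M` compact
Hausdorff with an atlas on `EuclideanSpace ℝ (Fin d)` and `K ⊆ M` closed with `↥K` locally
contractible, `K` carries a tautness datum `Cech.RetractionNhds K` (`M` embeds in some `ℝᴺ` with
image a neighbourhood retract, `exists_isClosedEmbedding_pi_of_compactSpace`,
`isNeighbourhoodRetract_range_of_compactSpace`; then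
`Cech.RetractionNhds.nonempty_of_locallyContractibleSpace`).
[cite: Spanier1981, Ch. 6 §1, Thm. 10] [cite: HatcherAT2002, Thm. A.7 and Cor. A.9] -/
theorem nonempty_retractionNhds_of_locallyContractibleSpace {M : Type u} [TopologicalSpace M]
    [CompactSpace M] [T2Space M] (d : ℕ) [ChartedSpace (EuclideanSpace ℝ (Fin d)) M] {K : Set M}
    (hK : IsClosed K) (hLC : LocallyContractibleSpace K) : Nonempty (Cech.RetractionNhds K) := by
  obtain ⟨N, f, hf⟩ := Literature.Geometry.Manifold.exists_isClosedEmbedding_pi_of_compactSpace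
    (M := M) (EuclideanSpace ℝ (Fin d))
  have hNR : IsNeighbourhoodRetract (Set.range f) :=
    isNeighbourhoodRetract_range_of_compactSpace
      isNeighbourhoodRetract_of_locallyContractibleSpace_holds (EuclideanSpace ℝ (Fin d))
      hf.isEmbedding
  exact Cech.RetractionNhds.nonempty_of_locallyContractibleSpace (K := K) hf.isEmbedding hNR
    hK.isCompact hLC

/-- **Relative-homeomorphism excision for compact manifolds** (Spanier 1966, Ch. 6 §6 Thm. 5
with §1 Thm. 10; Hatcher 2002, Prop. 2.22): let `M`, `M'` be compact Hausdorff spaces with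
Euclidean atlases, `K ⊆ M` closed, `f : M' → M` continuous, injective off `f⁻¹K` and with
`M ∖ K ⊆ f(M')`, and suppose `↥K` and `↥(f⁻¹K)` are locally contractible. Then
`f^* : Hⁿ(M, K; Md) → Hⁿ(M', f⁻¹K; Md)` is bijective for every `n` (`f` is closed, being a map
from a compact to a Hausdorff space; `bijective_relMap_of_relativeHomeomorph` with the tautness
data of `nonempty_retractionNhds_of_locallyContractibleSpace`).
[cite: Spanier1981, Ch. 6 §6, Thm. 5] [cite: HatcherAT2002, Prop. 2.22] -/
theorem bijective_relMap_of_relativeHomeomorph_of_chartedSpace {M M' : Type u}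
    [TopologicalSpace M] [CompactSpace M] [T2Space M] (d : ℕ)
    [ChartedSpace (EuclideanSpace ℝ (Fin d)) M] [TopologicalSpace M'] [CompactSpace M'] [T2Space M']
    (d' : ℕ) [ChartedSpace (EuclideanSpace ℝ (Fin d')) M'] {K : Set M} (hK : IsClosed K)
    (hLC : LocallyContractibleSpace K) (f : C(M', M)) (hLC' : LocallyContractibleSpace ↥(f ⁻¹' K))
    (hinj : InjOn f (f ⁻¹' K)ᶜ) (hsurj : Kᶜ ⊆ range f) (n : ℕ) :
    Function.Bijective (relSingularCohomology.map R Md f (mapsTo_preimage_pair f K) n) := by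
  obtain ⟨T⟩ := nonempty_retractionNhds_of_locallyContractibleSpace d hK hLC
  obtain ⟨T'⟩ := nonempty_retractionNhds_of_locallyContractibleSpace d'
    (hK.preimage f.continuous) hLC'
  exact bijective_relMap_of_relativeHomeomorph f hK f.continuous.isClosedMap hinj hsurj T T' n

/-- **The abstract transfer.** For a map of pairs `f : (M', f⁻¹K) → (M, K)` such that
`f^* : Hⁿ(M, K) → Hⁿ(M', f⁻¹K)` is surjective and `f^* : Hⁿ(M) → Hⁿ(M')` is injective, a class
`v ∈ Hⁿ(M; Md)` whose pull-back `f^* v` vanishes on `f⁻¹K` vanishes on `K`: `f^* v = j'(b)` with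
`b ∈ Hⁿ(M', f⁻¹K)` (exactness), `b = f^* a`, and `f^*(j a) = j'(f^* a) = f^* v` forces `v = j a`,
which dies on `K` (Voisin II, proof of Thm. 10.17: the chase in the ladder of the two long exact
sequences). [cite: VoisinHodgeII2003, §10.2, proof of Thm. 10.17] [cite: HatcherAT2002, §3.1 p. 200] -/
theorem singularCohomology_map_subsetIncl_eq_zero_of_map_preimage {M M' : Type u}
    [TopologicalSpace M] [TopologicalSpace M'] {K : Set M} (f : C(M', M)) {n : ℕ}
    (hsurj : Function.Surjective (relSingularCohomology.map R Md f (mapsTo_preimage_pair f K) n))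
    (hinj : Function.Injective (singularCohomology.map R Md f n)) (v : singularCohomology R Md M n)
    (hv : singularCohomology.map R Md (subsetIncl (f ⁻¹' K)) n (singularCohomology.map R Md f n v) = 0) :
    singularCohomology.map R Md (subsetIncl K) n v = 0 := by
  obtain ⟨b, hb⟩ := (ShortComplex.moduleCat_exact_iff _).1
    (relSingularCohomology.exact_toAbsolute_map (R := R) (M := Md) (f ⁻¹' K) n) _ hv
  obtain ⟨a, rfl⟩ := hsurj b
  have ha : singularCohomology.map R Md f n (relSingularCohomology.toAbsolute R Md M K n a) =
      singularCohomology.map R Md f n v := by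
    rw [← hb, ← ModuleCat.comp_apply, ← relSingularCohomology.map_comp_toAbsolute,
      ModuleCat.comp_apply]
  rw [← hinj ha, ← ModuleCat.comp_apply, toAbsolute_comp_map_subsetIncl R Md K n]
  rfl

end Topological

/-! ### Complex points of smooth projective varieties -/

section Algebraic

open Motives

variable {n : ℕ} {X' X : Motives.SchemeOver ℂ}

/-- **`σ^*` is injective for a birational morphism of smooth projective `n`-folds** (Fulton 1998,
Lemma 19.1.2: `σ_*[X'] = [X]`, so `σ_!(σ^* c) = c` by the projection formula; Voisin I,
Lemma 7.28). In degrees `k > 2n` both sides vanish. [cite: Fulton1998, Lemma 19.1.2 and §1.4]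
[cite: VoisinHodgeI2002, §7.3.2 Lemma 7.28] -/
theorem complexBetti_map_injective_of_isBirational (hX' : IsSmoothProjective n X')
    (hX : IsSmoothProjective n X) (σ : X' ⟶ X) (hσ : Resolution.IsBirational σ.left) (k : ℕ) :
    Function.Injective (complexBetti.map σ k) := by
  by_cases hk : k ≤ 2 * n
  · obtain ⟨μ, ν, hdeg⟩ := exists_hasDegree_one_of_isBirational hX' hX σ hσ
    have hν : ν.HasPoincareDuality := fun _ _ h ↦
      ComplexPoints.bijective_poincareDualityMap_of (fun ν' _ _ h' ↦ poincare_duality ν' h') hX ν h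
    have h : k + (2 * n - k) = 2 * n := by omega
    intro a b hab
    have ha := gysinMap_map_of_hasDegree hν hdeg h a
    have hb := gysinMap_map_of_hasDegree hν hdeg h b
    rw [one_smul] at ha hb
    rw [← ha, ← hb]
    exact congrArg _ hab
  · haveI := subsingleton_complexBetti hX (k := k) (by omega)
    exact fun a b _ ↦ Subsingleton.elim a b

/-- **A morphism which is an isomorphism over an open `U ⊆ X` is injective on complex points over
`U(ℂ)`**: if `σ|_U : σ⁻¹U ⟶ U` is an isomorphism, `Q`, `Q'` are complex points of `X'` with
`σ(Q)` over `U` and `σ(Q) = σ(Q')`, then `Q = Q'` (both lift to `σ⁻¹U(ℂ)`, on which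
`σ(ℂ) = (σ⁻¹U ≅ U ↪ X)(ℂ)` is injective, SGA1 XII Prop. 3.1 (xi): the tree's
`AlgPoints.isOpenEmbedding_map_holds`). [cite: SGA1, Exp. XII Prop. 3.1 (xi)] -/
theorem AlgPoints.eq_of_map_eq_of_isIso_restrict (σ : X' ⟶ X) (U : X.left.Opens)
    [IsIso (σ.left ∣_ U)] {Q Q' : ComplexPoints X'} (hQ : (AlgPoints.map σ Q).pt ∈ U)
    (h : AlgPoints.map σ Q = AlgPoints.map σ Q') : Q = Q' := by
  set V : X'.left.Opens := σ.left ⁻¹ᵁ U with hV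
  set j : openSubschemeOver X' V ⟶ X' := openSubschemeOverι X' V with hj
  set g : openSubschemeOver X' V ⟶ X := restrictOverHom σ U ≫ openSubschemeOverι X U with hg
  haveI : IsOpenImmersion j.left := inferInstanceAs (IsOpenImmersion V.ι)
  haveI : IsOpenImmersion g.left := by
    change IsOpenImmersion ((σ.left ∣_ U) ≫ U.ι)
    infer_instance
  have hjg : j ≫ σ = g := (restrictOverHom_comp_openSubschemeOverι σ U).symm
  -- both points lie over `V = σ⁻¹U`, hence lift along `j`
  have hlift : ∀ P : ComplexPoints X', (AlgPoints.map σ P).pt ∈ U →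
      ∃ w : ComplexPoints (openSubschemeOver X' V), AlgPoints.map j w = P := by
    intro P hP
    have hPV : P.pt ∈ V := by rwa [AlgPoints.pt_map] at hP
    have hr : P ∈ Set.range (AlgPoints.map j : ComplexPoints (openSubschemeOver X' V) →
        ComplexPoints X') := by
      rw [AlgPoints.range_map_of_isOpenImmersion_holds j]
      change P.pt ∈ V.ι.opensRange
      rwa [Scheme.Opens.opensRange_ι]
    exact hr
  have hQ' : (AlgPoints.map σ Q').pt ∈ U := by rw [← h]; exact hQ
  obtain ⟨w, rfl⟩ := hlift Q hQ
  obtain ⟨w', rfl⟩ := hlift Q' hQ'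
  rw [← AlgPoints.map_comp_apply, ← AlgPoints.map_comp_apply, hjg] at h
  rw [(AlgPoints.isOpenEmbedding_map_holds (L := ℂ) g).injective h]

/-- **A morphism which is an isomorphism over an open `U ⊆ X` is surjective onto the complex points
over `U(ℂ)`**: every complex point `P` of `X` with `P.pt ∈ U` is `σ(Q)` for some complex point `Q`
of `X'` (lift `P` along the open immersion `σ⁻¹U ≅ U ↪ X`, SGA1 XII Thm. 1.1 proof a): the tree's
`AlgPoints.range_map_of_isOpenImmersion_holds`). [cite: SGA1, Exp. XII Thm. 1.1, proof a)] -/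
theorem AlgPoints.exists_map_eq_of_isIso_restrict (σ : X' ⟶ X) (U : X.left.Opens)
    [IsIso (σ.left ∣_ U)] (P : ComplexPoints X) (hP : P.pt ∈ U) :
    ∃ Q : ComplexPoints X', AlgPoints.map σ Q = P := by
  set V : X'.left.Opens := σ.left ⁻¹ᵁ U with hV
  set j : openSubschemeOver X' V ⟶ X' := openSubschemeOverι X' V with hj
  set g : openSubschemeOver X' V ⟶ X := restrictOverHom σ U ≫ openSubschemeOverι X U with hg
  haveI : IsOpenImmersion g.left := by
    change IsOpenImmersion ((σ.left ∣_ U) ≫ U.ι)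
    infer_instance
  have hjg : j ≫ σ = g := (restrictOverHom_comp_openSubschemeOverι σ U).symm
  -- `P.pt ∈ U` lies in the image of `g = (σ⁻¹U ≅ U ↪ X)`
  have hP' : P.pt ∈ g.left.opensRange := by
    obtain ⟨y, hy⟩ := (Scheme.homeoOfIso (asIso (σ.left ∣_ U))).surjective ⟨P.pt, hP⟩
    refine ⟨y, ?_⟩
    change ((σ.left ∣_ U) ≫ U.ι) y = P.pt
    rw [Scheme.Hom.comp_apply]
    have hy' : (σ.left ∣_ U) y = ⟨P.pt, hP⟩ := hy
    rw [hy']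
    rfl
  obtain ⟨w, hw⟩ : P ∈ Set.range (AlgPoints.map g : ComplexPoints (openSubschemeOver X' V) →
      ComplexPoints X) := by
    rw [AlgPoints.range_map_of_isOpenImmersion_holds g]
    exact hP'
  exact ⟨AlgPoints.map j w, by rw [← AlgPoints.map_comp_apply, hjg, hw]⟩

/-- **Transfer of Deligne's kernel along a proper modification which is an isomorphism off `Z`**
(the step `Z ⊆ X ↝ E = σ⁻¹Z ⊆ X̃` in every resolution-based proof of Hodge III Prop. 8.2.7; Voisin
II, proof of Thm. 10.17; Spanier Ch. 6 §6 Thm. 5). Let `X'`, `X` be smooth projective of dimension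
`n`, `σ : X' ⟶ X` birational and an isomorphism over the open `U ⊆ X`, and put `Z = X ∖ U`,
`E = σ⁻¹Z`. If `v ∈ Hᵏ(X(ℂ); ℂ)` is such that `σ^* v` vanishes on `E(ℂ) = {Q | σ(Q).pt ∉ U}`, then
`v` vanishes on `Z(ℂ) = {P | P.pt ∉ U}`. Proof: the map of compact pairs
`σ(ℂ) : (X'(ℂ), E(ℂ)) → (X(ℂ), Z(ℂ))` is a relative homeomorphism
(`AlgPoints.eq_of_map_eq_of_isIso_restrict`, `AlgPoints.exists_map_eq_of_isIso_restrict`) of pairs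
with locally contractible closed parts (`locallyContractibleSpace_complexPoints_of_isSmoothProjective`),
so `σ^* : Hᵏ(X, Z) ≅ Hᵏ(X', E)` (`bijective_relMap_of_relativeHomeomorph_of_chartedSpace`), and
`σ^* : Hᵏ(X) ↪ Hᵏ(X')` (`complexBetti_map_injective_of_isBirational`); conclude by
`singularCohomology_map_subsetIncl_eq_zero_of_map_preimage`.
[cite: DeligneHodgeIII1974, Prop. 8.2.7] [cite: VoisinHodgeII2003, §10.2, proof of Thm. 10.17]
[cite: Spanier1981, Ch. 6 §6, Thm. 5] -/
theorem singularCohomology_map_eq_zero_of_map_preimage_eq_zero_of_isIso_restrict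
    (hX' : IsSmoothProjective n X') (hX : IsSmoothProjective n X) (σ : X' ⟶ X)
    (hσ : Resolution.IsBirational σ.left) (U : X.left.Opens) [IsIso (σ.left ∣_ U)] {k : ℕ}
    (v : complexBetti X k)
    (hv : singularCohomology.map ℂ ℂ
      (⟨Subtype.val, continuous_subtype_val⟩ :
        C({Q : ComplexPoints X' // (AlgPoints.map σ Q).pt ∉ U}, ComplexPoints X')) k
      (complexBetti.map σ k v) = 0) :
    singularCohomology.map ℂ ℂ
      (⟨Subtype.val, continuous_subtype_val⟩ : C({P : ComplexPoints X // P.pt ∉ U}, ComplexPoints X))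
        k v = 0 := by
  letI := hX.chartedSpace
  letI := hX'.chartedSpace
  haveI := ComplexPoints.compactSpace_of_isSmoothProjective hX
  haveI := ComplexPoints.compactSpace_of_isSmoothProjective hX'
  haveI := ComplexPoints.t2Space_of_isSmoothProjective hX
  haveI := ComplexPoints.t2Space_of_isSmoothProjective hX'
  -- the closed set `K = Z(ℂ)` and its preimage `E(ℂ)`
  set f : C(ComplexPoints X', ComplexPoints X) := AlgPoints.mapContinuous (L := ℂ) σ with hf
  set K : Set (ComplexPoints X) := {P | P.pt ∈ ((U : Set X.left))ᶜ} with hK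
  have hZ : IsClosed ((U : Set X.left))ᶜ := U.2.isClosed_compl
  have hKc : IsClosed K := by
    have ho := AlgPoints.isOpen_setOf_pt_mem (L := ℂ) U
    have : K = {P : ComplexPoints X | P.pt ∈ U}ᶜ := by ext P; rfl
    rw [this]
    exact ho.isClosed_compl
  have hLC : LocallyContractibleSpace K :=
    locallyContractibleSpace_complexPoints_of_isSmoothProjective hX _ hZ
  have hLC' : LocallyContractibleSpace ↥(f ⁻¹' K) :=
    locallyContractibleSpace_complexPoints_of_isSmoothProjective hX' (σ.left.base ⁻¹' (U : Set X.left)ᶜ)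
      (hZ.preimage σ.left.continuous)
  -- `f` is injective off `f⁻¹K` and onto `Kᶜ`
  have hinj : InjOn f (f ⁻¹' K)ᶜ := fun Q hQ Q' _ h ↦
    AlgPoints.eq_of_map_eq_of_isIso_restrict σ U (not_notMem.1 hQ) h
  have hsurj : Kᶜ ⊆ range f := fun P hP ↦
    AlgPoints.exists_map_eq_of_isIso_restrict σ U P (not_notMem.1 hP)
  have hrel := bijective_relMap_of_relativeHomeomorph_of_chartedSpace (R := ℂ) (Md := ℂ) (2 * n) (2 * n)
    hKc hLC f hLC' hinj hsurj k
  exact singularCohomology_map_subsetIncl_eq_zero_of_map_preimage (R := ℂ) (Md := ℂ) f hrel.2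
    (complexBetti_map_injective_of_isBirational hX' hX σ hσ k) v hv

end Algebraic

end Literature.AlgebraicGeometry.HodgeTheory

end
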